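import Summits.AtomisticToContinuum.FouriersLaw.Theorems.BondHeatUncertaintyExtensiveSnapshotIrreversibilityNessDensityPos
import Summits.AtomisticToContinuum.FouriersLaw.Theorems.BondHeatUncertaintyExtensiveSnapshotIrreversibilityLogDensityRegularityAux1
import HarnessLib

/-!
# Crux `ExtensiveSnapshotIrreversibility` (stmt-AtomisticToContinuum-9121), line `clausius-budget-sound-window`:
sub-goal `ness_eq_gibbs_withDensity_exp` — clause (R1) of stub S1r' `stub_oddLogDensityRegularity`

The registered sub-goal `ness_eq_gibbs_withDensity_exp` (clause (R1) of the lead's checked skeleton v8,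
stub S1r' `stub_oddLogDensityRegularity`): along EVERY steady-state family `μ` of the pinned anharmonic
chain `P = pinnedChain ω₂ lam β γ` (all parameters positive), for `T > 0` and `N ≥ 1`, there is ONE
function `φ : ℝ → PhaseSpace N → ℝ`, measurable in `x` for every `δ`, such that for every `|δ| < 2T`
(i.e. whenever both bath temperatures `T ± δ/2` are positive) the two-temperature steady state is the
Gibbs state at the mean temperature reweighted by `e^{φ_δ}`:
`μ_{N,T+δ/2,T-δ/2} = μ_T · e^{φ_δ}`, `μ_T = P.gibbsMeasure N T`.

No uniqueness guard is needed. Proof (pure assembly of landed facts): for `|δ| < 2T` the steady state has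
an everywhere positive `C^∞` Lebesgue density `ρ_δ` (`LogDensity.ness_density_pos`, p115843:
Hörmander + irreducibility + Lebesgue duality), and the bookkeeping bridge
`LogDensity.eq_gibbsMeasure_withDensity_exp_of_pos_density` (p105925) rewrites `ρ_δ · Leb` as
`μ_T · e^{φ_δ}` with the explicit `φ_δ = log ρ_δ + H/T + log ∫ e^{-H/T}`; the function `φ` is assembled
over `δ` by choice (junk value `0` for `|δ| ≥ 2T`).

References: L. Rey-Bellet, L. E. Thomas, CMP 225 (2002) 305–329, Thm 2.1; N. Cuneo, J.-P. Eckmann,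
M. Hairer, L. Rey-Bellet, EJP 23 (2018) no. 55, Thm 2.13.
-/

noncomputable section

namespace Summit.AtomisticToContinuum.FouriersLaw.Theorems.ExtensiveSnapshotIrreversibility.ClausiusBudget

open MeasureTheory Filter Topology
open scoped ENNReal NNReal
open Literature.MathematicalPhysics.KineticTheory.HeatConduction

namespace LogDensity

/-- **Clause (R1) of stub S1r': the two-temperature NESS is a Gibbs reweighting** (registered sub-goal
`ness_eq_gibbs_withDensity_exp`, line `clausius-budget-sound-window`). Along every steady-state family
`μ` of the pinned chain (all parameters `> 0`), for `T > 0`, `N ≥ 1`, there is `φ : ℝ → PhaseSpace N → ℝ`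
with every `φ δ` measurable and, for all `|δ| < 2T`,
`μ N (T + δ/2) (T - δ/2) = (gibbsMeasure N T).withDensity (ofReal ∘ exp ∘ φ δ)`.
Assembly of `ness_density_pos` (positive smooth NESS density) and
`eq_gibbsMeasure_withDensity_exp_of_pos_density` (`φ_δ = log ρ_δ + H/T + log Z_T`). [folklore] -/
theorem ness_eq_gibbs_withDensity_exp :
    ∀ ω₂ lam β γ : ℝ, 0 < ω₂ → 0 < lam → 0 < β → 0 < γ →
      ∀ μ : (N : ℕ) → ℝ → ℝ → Measure (PhaseSpace N),
        (∀ (N : ℕ) (T_L T_R : ℝ), 0 < T_L → 0 < T_R →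
          (pinnedChain ω₂ lam β γ).IsSteadyState N T_L T_R (μ N T_L T_R)) →
        ∀ T : ℝ, 0 < T → ∀ N : ℕ, 0 < N →
          ∃ φ : ℝ → PhaseSpace N → ℝ, (∀ δ : ℝ, Measurable (φ δ)) ∧
            ∀ δ : ℝ, |δ| < 2 * T →
              μ N (T + δ / 2) (T - δ / 2) =
                ((pinnedChain ω₂ lam β γ).gibbsMeasure N T).withDensity
                  (fun x => ENNReal.ofReal (Real.exp (φ δ x))) := by
  intro ω₂ lam β γ hω hl hβ hγ μ hμ T hT N hN
  -- pointwise in `δ`: a measurable exponent, with the reweighting identity when `|δ| < 2T`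
  have key : ∀ δ : ℝ, ∃ ψ : PhaseSpace N → ℝ, Measurable ψ ∧
      (|δ| < 2 * T → μ N (T + δ / 2) (T - δ / 2) =
        ((pinnedChain ω₂ lam β γ).gibbsMeasure N T).withDensity
          (fun x => ENNReal.ofReal (Real.exp (ψ x)))) := by
    intro δ
    by_cases hδ : |δ| < 2 * T
    · have h1 := abs_lt.1 hδ
      have hL : 0 < T + δ / 2 := by linarith [h1.1]
      have hR : 0 < T - δ / 2 := by linarith [h1.2]
      obtain ⟨ρ, hρs, hρpos, hμρ⟩ := ness_density_pos ω₂ lam β γ hω hl hβ hγ N hN (T + δ / 2)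
        (T - δ / 2) hL hR (μ N (T + δ / 2) (T - δ / 2)) (hμ N _ _ hL hR)
      obtain ⟨hm, heq⟩ := eq_gibbsMeasure_withDensity_exp_of_pos_density hω hl.le hβ.le γ N hT
        hρs.continuous.measurable hρpos hμρ
      exact ⟨_, hm, fun _ => heq⟩
    · exact ⟨fun _ => 0, measurable_const, fun h => absurd h hδ⟩
  choose φ hφm hφeq using key
  exact ⟨φ, hφm, fun δ hδ => hφeq δ hδ⟩

end LogDensity

end Summit.AtomisticToContinuum.FouriersLaw.Theorems.ExtensiveSnapshotIrreversibility.ClausiusBudget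

end
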